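import Literature.Probability.Percolation.InterfaceTraversalBound
import HarnessLib

/-!
# The perturbed medial polygon is simple: distinct pieces are disjoint

Topic `Literature/Probability/LatticeModels` (companion to `MedialPerturbation.lean` and
`Percolation/ExplorationPolygon.lean`). The perturbed exploration polygon of a bond configuration
in a discrete Dobrushin domain (`IsMedialExploration.subPath`: dart pieces `dartPiece i`
alternating with connectors `connPiece i`, in `(1/8)`-lattice units at mesh `δ`) was introduced
to repair the self-touching of the medial polyline; `MedialPerturbation.lean` proves the local
"free segment" facts it was built for. This file proves that it is globally SIMPLE:

* `IsMedialExploration.disjoint_dartPiece` — distinct dart pieces are disjoint;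
* `IsMedialExploration.eq_or_eq_of_dartPiece_inter_connPiece` — the dart piece `i` meets the
  connector `j` only for `j = i` (at `pS i`) or `j = i + 1` (at `pT i`);
* `IsMedialExploration.eq_of_connPiece_inter_connPiece` — distinct connectors are disjoint;
* `IsMedialExploration.disjoint_range_subPath` — **stretches of the perturbed polygon over
  dart ranges separated by at least one index are disjoint** (the form consumed by the
  three-arcs lemma `Literature.Topology.PlaneTopology.not_three_arcs_touch` in the sector count of
  the multiple-crossing estimate for the FK interface, Aizenman–Burchard 1999, App. A;
  Duminil-Copin–Smirnov 2012, §6.1).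

The proofs are coordinate bookkeeping in `(1/8)ℤ`: every point of a dart piece has both
coordinates at distance `≥ 1/8` from `ℤ` and from `ℤ + ½` (`dartSeg_coord_ne`), while a
connector at the medial vertex `e` (the crossed or followed lattice edge) lies in the box
`N(e)` of points within `1/8` of the line of `e` across and within `1/8` of the midpoint of `e`
along (`VConnShape`/`FConnShape`); the boxes of distinct edges are disjoint
(`eq_of_nearEdge_of_nearEdge`), a dart piece meets such a box only at its own shifted side
points `dartPt`, which are injective in the dart (`eq_of_dartPt_eq`) and are endpoints of a
connector only when the connector is adjacent to the dart; two visits of the path to the same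
medial vertex turn around different vertices / inside different faces (no medial dart is used
twice, `corner_injective`) and are of the same kind (the edge is open or closed, not both,
`turn_cases`). No probability and no topology here.

## References

* S. Smirnov, *Critical percolation in the plane*, C. R. Acad. Sci. Paris 333 (2001), §2 (the
  exploration path drawn strictly inside the faces). [Smirnov2001]
* M. Aizenman, A. Burchard, Duke Math. J. 99 (1999), Appendix A. [AizenmanBurchardDuke1999]
-/

noncomputable section

namespace Literature.Probability.LatticeModels

open Set Complex Literature.Probability.Percolation

/-! ### Integer bookkeeping in real form -/

/-- Integers closer than `1` are equal (real form). [folklore] -/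
theorem int_eq_of_abs_sub_lt_one {a b : ℤ} (h1 : (a : ℝ) < b + 1) (h2 : (b : ℝ) < a + 1) : a = b := by
  have h1' : a < b + 1 := by exact_mod_cast h1
  have h2' : b < a + 1 := by exact_mod_cast h2
  omega

/-- There is no integer `h` with `x + 1/4 ≤ h ≤ x + 3/4` for an integer `x` (real form).
[folklore] -/
theorem int_not_mem_quarter_window {x h : ℤ} (h1 : (x : ℝ) + 1 / 4 ≤ h) (h2 : (h : ℝ) ≤ x + 3 / 4) : False := by
  have h1' : x < h := by
    have : (x : ℝ) < h := by linarith
    exact_mod_cast this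
  have h2' : h < x + 1 := by
    have : (h : ℝ) < x + 1 := by linarith
    exact_mod_cast this
  omega

/-! ### Segments and one coordinate -/

/-- **A point of a segment with the first endpoint's value of a coordinate in which the endpoints
differ is the first endpoint.** [folklore] -/
theorem eq_left_of_mem_segment_of_coordVec_eq {P Q z : ℂ} {k : Fin 2} (hPQ : coordVec P k ≠ coordVec Q k)
    (hz : z ∈ segment ℝ P Q) (h : coordVec z k = coordVec P k) : z = P := by
  rw [mem_segment_iff_coordVec] at hz
  obtain ⟨t, -, -, hc⟩ := hz
  have ht : t = 0 := by
    have hk := hc k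
    rw [h] at hk
    have : t * (coordVec Q k - coordVec P k) = 0 := by linarith
    rcases mul_eq_zero.1 this with h0 | h0
    · exact h0
    · exact absurd (sub_eq_zero.1 h0).symm hPQ
  refine eq_of_coordVec_eq fun m ↦ ?_
  rw [hc m, ht, zero_mul, add_zero]

/-- The same for the second endpoint. [folklore] -/
theorem eq_right_of_mem_segment_of_coordVec_eq {P Q z : ℂ} {k : Fin 2} (hPQ : coordVec P k ≠ coordVec Q k)
    (hz : z ∈ segment ℝ P Q) (h : coordVec z k = coordVec Q k) : z = Q :=
  eq_left_of_mem_segment_of_coordVec_eq hPQ.symm (segment_symm ℝ P Q ▸ hz) h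

/-- Along a segment whose endpoints agree in a coordinate, that coordinate is constant.
[folklore] -/
theorem coordVec_eq_of_mem_segment_of_coordVec_eq {P Q z : ℂ} {k : Fin 2} (hPQ : coordVec P k = coordVec Q k)
    (hz : z ∈ segment ℝ P Q) : coordVec z k = coordVec P k := by
  rw [mem_segment_iff_coordVec] at hz
  obtain ⟨t, -, -, hc⟩ := hz
  rw [hc k, hPQ, sub_self, mul_zero, add_zero]

/-! ### The shifted side points -/

/-- The values of `toward`. [folklore] -/
theorem toward_eq (v f : Site 2) (k : Fin 2) :
    (v k = f k ∧ toward v f k = 3 / 8) ∨ (v k ≠ f k ∧ toward v f k = 5 / 8) := by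
  unfold toward; split_ifs with h
  · exact Or.inl ⟨h, rfl⟩
  · exact Or.inr ⟨h, rfl⟩

/-- The values of `inward`. [folklore] -/
theorem inward_eq (v f : Site 2) (k : Fin 2) :
    (v k = f k ∧ inward v f k = 1 / 8) ∨ (v k ≠ f k ∧ inward v f k = 7 / 8) := by
  unfold inward; split_ifs with h
  · exact Or.inl ⟨h, rfl⟩
  · exact Or.inr ⟨h, rfl⟩

/-- `toward ≠ inward` in every direction. [folklore] -/
theorem toward_ne_inward (v f : Site 2) (k : Fin 2) : toward v f k ≠ inward v f k := by
  rcases toward_eq v f k with ⟨_, h⟩ | ⟨_, h⟩ <;> rcases inward_eq v f k with ⟨_, h'⟩ | ⟨_, h'⟩ <;>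
    rw [h, h'] <;> norm_num

/-- A shifted side point lies in its open face. [folklore] -/
theorem dartPt_mem_openSq (v f : Site 2) (i : Fin 2) : dartPt v f i ∈ openSq f := by
  intro k
  by_cases hk : k = i
  · subst hk
    rw [coordVec_dartPt_self]
    rcases toward_eq v f k with ⟨_, h⟩ | ⟨_, h⟩ <;> rw [h] <;> constructor <;> linarith
  · rw [coordVec_dartPt_of_ne _ _ hk]
    rcases inward_eq v f k with ⟨_, h⟩ | ⟨_, h⟩ <;> rw [h] <;> constructor <;> linarith

/-- Open faces of distinct indices are disjoint: a common point forces equal indices. [folklore] -/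
theorem eq_of_mem_openSq_of_mem_openSq {f g : Site 2} {z : ℂ} (hf : z ∈ openSq f) (hg : z ∈ openSq g) : f = g := by
  funext k
  obtain ⟨h1, h2⟩ := hf k
  obtain ⟨h3, h4⟩ := hg k
  exact int_eq_of_abs_sub_lt_one (by linarith) (by linarith)

/-- **The shifted side points determine the dart and the direction**: `dartPt v f i = dartPt v' f' i'`
for corners `(v, f)`, `(v', f')` forces `v = v'`, `f = f'`, `i = i'` (the face from the open
square, the direction from which coordinate lies in `{3/8, 5/8} + ℤ`, the corner from the
values of `toward`/`inward`). [folklore] -/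
theorem eq_of_dartPt_eq {v f v' f' : Site 2} (hv : IsCorner v f) (hv' : IsCorner v' f') {i i' : Fin 2}
    (h : dartPt v f i = dartPt v' f' i') : v = v' ∧ f = f' ∧ i = i' := by
  have hff : f = f' := eq_of_mem_openSq_of_mem_openSq (dartPt_mem_openSq v f i) (h ▸ dartPt_mem_openSq v' f' i')
  subst hff
  have hii : i = i' := by
    by_contra hne
    have h1 := coordVec_dartPt_self v f i
    have h2 := coordVec_dartPt_of_ne v' f (i := i') (k := i) hne
    rw [h] at h1
    rw [h1] at h2
    rcases toward_eq v f i with ⟨_, ht⟩ | ⟨_, ht⟩ <;> rcases inward_eq v' f i with ⟨_, hi⟩ | ⟨_, hi⟩ <;>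
      rw [ht, hi] at h2 <;> norm_num at h2
  subst hii
  refine ⟨?_, rfl, rfl⟩
  funext k
  by_cases hk : k = i
  · subst hk
    have h1 := coordVec_dartPt_self v f k
    have h2 := coordVec_dartPt_self v' f k
    rw [h, h2, add_right_inj] at h1
    -- `toward v' f k = toward v f k`
    rcases toward_eq v f k with ⟨hv1, ht⟩ | ⟨hv1, ht⟩ <;> rcases toward_eq v' f k with ⟨hv2, ht'⟩ | ⟨hv2, ht'⟩ <;>
      rw [ht, ht'] at h1 <;> norm_num at h1
    · rw [hv1, hv2]
    · rcases hv k with h' | h' <;> rcases hv' k with h'' | h'' <;> omega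
  · have h1 := coordVec_dartPt_of_ne v f hk
    have h2 := coordVec_dartPt_of_ne v' f hk
    rw [h, h2, add_right_inj] at h1
    rcases inward_eq v f k with ⟨hv1, ht⟩ | ⟨hv1, ht⟩ <;> rcases inward_eq v' f k with ⟨hv2, ht'⟩ | ⟨hv2, ht'⟩ <;>
      rw [ht, ht'] at h1 <;> norm_num at h1
    · rw [hv1, hv2]
    · rcases hv k with h' | h' <;> rcases hv' k with h'' | h'' <;> omega

/-! ### Extreme coordinates on a dart piece are attained only at its endpoints -/

/-- **A point of the dart piece whose coordinate `k` has the value `f k + toward v f k` of the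
shifted side point in direction `k` is that side point.** [folklore] -/
theorem eq_dartPt_of_mem_dartSeg_of_coordVec_eq_toward {v f : Site 2} {z : ℂ} (hz : z ∈ dartSeg v f)
    (k : Fin 2) (h : coordVec z k = f k + toward v f k) : z = dartPt v f k := by
  rcases fin_two_eq_zero_or_one k with rfl | rfl
  · refine eq_left_of_mem_segment_of_coordVec_eq (k := 0) ?_ hz ?_
    · rw [coordVec_dartPt_self, coordVec_dartPt_of_ne _ _ (show (0 : Fin 2) ≠ 1 by decide)]
      exact fun h' ↦ toward_ne_inward v f 0 (add_left_cancel h')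
    · rw [h, coordVec_dartPt_self]
  · refine eq_right_of_mem_segment_of_coordVec_eq (k := 1) ?_ hz ?_
    · rw [coordVec_dartPt_self, coordVec_dartPt_of_ne _ _ (show (1 : Fin 2) ≠ 0 by decide)]
      exact fun h' ↦ toward_ne_inward v f 1 (add_left_cancel h').symm
    · rw [h, coordVec_dartPt_self]

/-- **A point of the dart piece whose coordinate `j` has the value `f j + inward v f j` is the
shifted side point in the other direction.** [folklore] -/
theorem eq_dartPt_of_mem_dartSeg_of_coordVec_eq_inward {v f : Site 2} {z : ℂ} (hz : z ∈ dartSeg v f)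
    {j k : Fin 2} (hjk : j ≠ k) (h : coordVec z j = f j + inward v f j) : z = dartPt v f k := by
  rcases fin_two_eq_other hjk with ⟨rfl, rfl⟩ | ⟨rfl, rfl⟩
  · -- `k = 0`, `j = 1`
    refine eq_left_of_mem_segment_of_coordVec_eq (k := 1) ?_ hz ?_
    · rw [coordVec_dartPt_of_ne _ _ (show (1 : Fin 2) ≠ 0 by decide), coordVec_dartPt_self]
      exact fun h' ↦ toward_ne_inward v f 1 (add_left_cancel h').symm
    · rw [h, coordVec_dartPt_of_ne _ _ (show (1 : Fin 2) ≠ 0 by decide)]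
  · -- `k = 1`, `j = 0`
    refine eq_right_of_mem_segment_of_coordVec_eq (k := 0) ?_ hz ?_
    · rw [coordVec_dartPt_self, coordVec_dartPt_of_ne _ _ (show (0 : Fin 2) ≠ 1 by decide)]
      exact fun h' ↦ toward_ne_inward v f 0 (add_left_cancel h')
    · rw [h, coordVec_dartPt_of_ne _ _ (show (0 : Fin 2) ≠ 1 by decide)]

/-- **A dart-piece point with a coordinate in `{a + 3/8, a + 5/8}` (`a ∈ ℤ`) is the shifted side
point in that direction.** [folklore] -/
theorem eq_dartPt_of_mem_dartSeg_of_coordVec_toward' {v f : Site 2} (hv : IsCorner v f) {z : ℂ}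
    (hz : z ∈ dartSeg v f) (k : Fin 2) {a : ℤ}
    (h : coordVec z k = a + 3 / 8 ∨ coordVec z k = a + 5 / 8) : z = dartPt v f k := by
  refine eq_dartPt_of_mem_dartSeg_of_coordVec_eq_toward hz k ?_
  obtain ⟨h1, h2⟩ := dartSeg_subset_openSq hv hz k
  have ha : a = f k := by
    rcases h with h | h <;> rw [h] at h1 h2 <;> exact int_eq_of_abs_sub_lt_one (by linarith) (by linarith)
  subst ha
  have hc := dartSeg_coord hz k
  rcases toward_eq v f k with ⟨hvk, ht⟩ | ⟨hvk, ht⟩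
  · obtain ⟨h3, h4⟩ := hc.1 hvk
    rw [ht]
    rcases h with h | h
    · exact h
    · rw [h] at h4; linarith
  · have hvk' : v k = f k + 1 := by rcases hv k with h' | h' <;> omega
    obtain ⟨h3, h4⟩ := hc.2 hvk'
    rw [ht]
    rcases h with h | h
    · rw [h] at h3; linarith
    · exact h

/-- **A dart-piece point with a coordinate in `{b + 1/8, b + 7/8}` (`b ∈ ℤ`) is the shifted side
point in the other direction.** [folklore] -/
theorem eq_dartPt_of_mem_dartSeg_of_coordVec_inward' {v f : Site 2} (hv : IsCorner v f) {z : ℂ}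
    (hz : z ∈ dartSeg v f) {j k : Fin 2} (hjk : j ≠ k) {b : ℤ}
    (h : coordVec z j = b + 1 / 8 ∨ coordVec z j = b + 7 / 8) : z = dartPt v f k := by
  refine eq_dartPt_of_mem_dartSeg_of_coordVec_eq_inward hz hjk ?_
  obtain ⟨h1, h2⟩ := dartSeg_subset_openSq hv hz j
  have hb : b = f j := by
    rcases h with h | h <;> rw [h] at h1 h2 <;> exact int_eq_of_abs_sub_lt_one (by linarith) (by linarith)
  subst hb
  have hc := dartSeg_coord hz j
  rcases inward_eq v f j with ⟨hvj, hi⟩ | ⟨hvj, hi⟩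
  · obtain ⟨h3, h4⟩ := hc.1 hvj
    rw [hi]
    rcases h with h | h
    · exact h
    · rw [h] at h4; linarith
  · have hvj' : v j = f j + 1 := by rcases hv j with h' | h' <;> omega
    obtain ⟨h3, h4⟩ := hc.2 hvj'
    rw [hi]
    rcases h with h | h
    · rw [h] at h3; linarith
    · exact h

/-! ### The box of a lattice edge containing its connectors -/

/-- `NearEdge I a h z`: the point `z` lies in the box of the lattice edge in direction `I` from
column `a` to `a + 1` at level `h` (coordinate `I` within `1/8` of the midpoint `a + ½`,
coordinate across within `1/8` of `h`) — the box containing every connector at that medial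
vertex. [folklore] -/
def NearEdge (I : Fin 2) (a h : ℤ) (z : ℂ) : Prop :=
  ((a : ℝ) + 3 / 8 ≤ coordVec z I ∧ coordVec z I ≤ a + 5 / 8) ∧
    ∀ J, J ≠ I → (h : ℝ) - 1 / 8 ≤ coordVec z J ∧ coordVec z J ≤ h + 1 / 8

/-- A vertex connector lies in the box of the crossed edge. [folklore] -/
theorem VConnShape.nearEdge {I J : Fin 2} {a g : ℤ} {z : ℂ} (h : VConnShape I J a g z) : NearEdge I a g z := by
  obtain ⟨hJI, hI, hJ1, hJ2⟩ := h
  refine ⟨?_, fun J' hJ' ↦ ?_⟩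
  · rcases hI with h | h <;> rw [h] <;> constructor <;> linarith
  · have : J' = J := by
      rcases fin_two_cases_of_ne hJI J' with h' | h'
      · exact absurd h' hJ'
      · exact h'
    subst this
    exact ⟨hJ1, hJ2⟩

/-- A face connector at level `b + 1/8` lies in the box of the lower side, one at level
`b + 7/8` in the box of the upper side. [folklore] -/
theorem FConnShape.nearEdge {I J : Fin 2} {a b : ℤ} {z : ℂ} (h : FConnShape I J a b z) :
    (coordVec z J = b + 1 / 8 ∧ NearEdge I a b z) ∨ (coordVec z J = b + 7 / 8 ∧ NearEdge I a (b + 1) z) := by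
  obtain ⟨hJI, hI, hJ⟩ := h
  have hoth : ∀ J', J' ≠ I → J' = J := fun J' hJ' ↦ by
    rcases fin_two_cases_of_ne hJI J' with h' | h'
    · exact absurd h' hJ'
    · exact h'
  rcases hJ with hJ | hJ
  · refine Or.inl ⟨hJ, hI, fun J' hJ' ↦ ?_⟩
    rw [hoth J' hJ', hJ]; constructor <;> linarith
  · refine Or.inr ⟨hJ, hI, fun J' hJ' ↦ ?_⟩
    rw [hoth J' hJ', hJ]; push_cast; constructor <;> linarith

/-- **The boxes of distinct lattice edges are disjoint**: a common point forces the same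
direction, column and level. [folklore] -/
theorem eq_of_nearEdge_of_nearEdge {I I' : Fin 2} {a h a' h' : ℤ} {z : ℂ} (h1 : NearEdge I a h z)
    (h2 : NearEdge I' a' h' z) : I = I' ∧ a = a' ∧ h = h' := by
  obtain ⟨⟨hI1, hI2⟩, hJ⟩ := h1
  obtain ⟨⟨hI1', hI2'⟩, hJ'⟩ := h2
  by_cases hII : I = I'
  · subst hII
    obtain ⟨J, hJI⟩ := exists_ne I
    obtain ⟨hJ1, hJ2⟩ := hJ J hJI
    obtain ⟨hJ1', hJ2'⟩ := hJ' J hJI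
    exact ⟨rfl, int_eq_of_abs_sub_lt_one (by linarith) (by linarith),
      int_eq_of_abs_sub_lt_one (by linarith) (by linarith)⟩
  · exfalso
    -- coordinate `I` is within `1/8` of the integer `h'` and within `1/8` of `a + 1/2`
    obtain ⟨hK1, hK2⟩ := hJ' I hII
    exact int_not_mem_quarter_window (x := a) (h := h') (by linarith) (by linarith)

/-- **A dart piece meets the box of an edge only at its shifted side point in the direction of the
edge**, which then lies at a corner of the box (its coordinate across is `h ± 1/8`). [folklore] -/
theorem eq_dartPt_of_mem_dartSeg_of_nearEdge {v f : Site 2} (hv : IsCorner v f) {z : ℂ} (hz : z ∈ dartSeg v f)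
    {I : Fin 2} {a h : ℤ} (hN : NearEdge I a h z) :
    z = dartPt v f I ∧ ∀ J, J ≠ I → coordVec z J = h - 1 / 8 ∨ coordVec z J = h + 1 / 8 := by
  obtain ⟨⟨hI1, hI2⟩, hJ⟩ := hN
  have hwin := (dartSeg_coord_ne hv hz I a).2
  have hIval : coordVec z I = a + 3 / 8 ∨ coordVec z I = a + 5 / 8 := by
    by_contra hne
    push Not at hne
    exact hwin ⟨lt_of_le_of_ne hI1 (Ne.symm hne.1), lt_of_le_of_ne hI2 hne.2⟩
  refine ⟨eq_dartPt_of_mem_dartSeg_of_coordVec_toward' hv hz I hIval, fun J hJI ↦ ?_⟩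
  obtain ⟨hJ1, hJ2⟩ := hJ J hJI
  have hwinJ := (dartSeg_coord_ne hv hz J h).1
  by_contra hne
  push Not at hne
  exact hwinJ ⟨lt_of_le_of_ne hJ1 (Ne.symm hne.1), lt_of_le_of_ne hJ2 hne.2⟩

/-! ### The source edge determines the face at a given corner -/

/-- **At a fixed vertex, the source medial vertex determines the dart**: two corners `(v, f)`,
`(v, f')` with the same source edge have `f = f'` (of the two faces at `v` containing that edge,
it is the source of one and the target of the other). [folklore] -/
theorem eq_of_cornerSource_eq {v f f' : Site 2} (hv : IsCorner v f) (hv' : IsCorner v f')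
    (h : cornerSource v f = cornerSource v f') : f = f' := by
  rw [cornerSource_eq_cornerEdge, cornerSource_eq_cornerEdge] at h
  obtain ⟨hdir, hcol⟩ := cornerEdge_eq_cornerEdge_aux hv hv' rfl h
  have h0 := hv 0; have h1 := hv 1; have h0' := hv' 0; have h1' := hv' 1
  funext k
  unfold srcDir at hdir hcol
  by_cases hc : v 0 - f 0 = v 1 - f 1 <;> by_cases hc' : v 0 - f' 0 = v 1 - f' 1 <;>
    simp only [hc, hc', if_true, if_false] at hdir hcol <;>
    first
    | exact absurd hdir (by decide)
    | (rcases fin_two_eq_zero_or_one k with rfl | rfl <;> omega)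

/-! ### The pieces of the perturbed polygon -/

section IsMedialExploration

variable {D : DiscreteDobrushin} {ω : Percolation.BondConfig (Site 2)} {a : MedialVertex}
  {l : List MedialVertex} (hexp : IsMedialExploration D ω (a :: l))

/-- **The data of a connector.** For `1 ≤ i` and a point `z` of the `i`-th connector, in lattice
units: the common direction `I` of the target edge of dart `i - 1` and the source edge of dart
`i`, the segment `[dartPt (i-1) I, dartPt i I]` containing `δ⁻¹ z`, and either the vertex-turn
data (same vertex, faces in the same `I`-column on either side of the line of level `cv i J`,
`VConnShape`, and the constant coordinate `I`) or the face-turn data (same face, corners spanning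
the followed side, `FConnShape` with its level implications). (Refines `connPiece_cases`.)
[cite: Smirnov2001, §2] -/
theorem IsMedialExploration.connPiece_data {i : ℕ} (hi1 : 1 ≤ i) (hi : i < ((a :: l).zip l).length)
    (hδ : 0 < D.δ) {z : ℂ} (hz : z ∈ hexp.connPiece i) :
    ∃ I J : Fin 2, J ≠ I ∧ tgtDir (hexp.cv (i - 1)) (hexp.cf (i - 1)) = I ∧ srcDir (hexp.cv i) (hexp.cf i) = I ∧
      D.δ⁻¹ • z ∈ segment ℝ (dartPt (hexp.cv (i - 1)) (hexp.cf (i - 1)) I) (dartPt (hexp.cv i) (hexp.cf i) I) ∧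
      ((hexp.cv (i - 1) = hexp.cv i ∧ hexp.cf (i - 1) ≠ hexp.cf i ∧ hexp.cf (i - 1) I = hexp.cf i I ∧
          ((hexp.cf (i - 1) J + 1 = hexp.cv i J ∧ hexp.cf i J = hexp.cv i J) ∨
            (hexp.cf (i - 1) J = hexp.cv i J ∧ hexp.cf i J + 1 = hexp.cv i J)) ∧
          VConnShape I J (hexp.cf i I) (hexp.cv i J) (D.δ⁻¹ • z) ∧
          coordVec (D.δ⁻¹ • z) I = hexp.cf i I + toward (hexp.cv i) (hexp.cf i) I) ∨
        (hexp.cf (i - 1) = hexp.cf i ∧ hexp.cv (i - 1) ≠ hexp.cv i ∧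
          hexp.cv (i - 1) I + hexp.cv i I = 2 * hexp.cf i I + 1 ∧ hexp.cv (i - 1) J = hexp.cv i J ∧
          FConnShape I J (hexp.cf i I) (hexp.cf i J) (D.δ⁻¹ • z) ∧
          (coordVec (D.δ⁻¹ • z) J = hexp.cf i J + 1 / 8 → hexp.cv i J = hexp.cf i J) ∧
          (coordVec (D.δ⁻¹ • z) J = hexp.cf i J + 7 / 8 → hexp.cv i J = hexp.cf i J + 1))) := by
  have he := hexp.cornerTarget_eq_cornerSource hi1 hi
  have hz' : D.δ⁻¹ • z ∈ segment ℝ (dartPt (hexp.cv (i - 1)) (hexp.cf (i - 1))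
      (tgtDir (hexp.cv (i - 1)) (hexp.cf (i - 1))))
      (dartPt (hexp.cv i) (hexp.cf i) (srcDir (hexp.cv i) (hexp.cf i))) := by
    rw [← mem_segment_smul_iff hδ.ne']
    exact hz
  rcases hexp.turn_cases hi1 hi with ⟨hv, hf, -, -⟩ | ⟨hf, hv, -, -⟩
  · -- vertex turn
    have hc₁ : IsCorner (hexp.cv i) (hexp.cf (i - 1)) := hv ▸ hexp.isCorner (i := i - 1) (by omega)
    obtain ⟨hdir, hcol, hside⟩ := vertexTurn_dirs hc₁ (hexp.isCorner hi) hf (hv ▸ he)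
    set I := tgtDir (hexp.cv i) (hexp.cf (i - 1)) with hI
    obtain ⟨J, hJI⟩ := exists_ne I
    have htgt : tgtDir (hexp.cv (i - 1)) (hexp.cf (i - 1)) = I := by rw [hv]
    rw [htgt, hdir] at hz'
    refine ⟨I, J, hJI, htgt, hdir, hz', Or.inl ⟨hv, hf, hcol, hside J hJI, ?_, ?_⟩⟩
    · rw [← hcol]
      have := vConn_shape hJI hcol (hside J hJI) (hv ▸ hz')
      exact this
    · -- the coordinate `I` is constant along the connector
      have hP : coordVec (dartPt (hexp.cv (i - 1)) (hexp.cf (i - 1)) I) I =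
          coordVec (dartPt (hexp.cv i) (hexp.cf i) I) I := by
        rw [coordVec_dartPt_self, coordVec_dartPt_self, hv]
        unfold toward
        rw [hcol]
      rw [coordVec_eq_of_mem_segment_of_coordVec_eq hP hz', coordVec_dartPt_self, hv]
      unfold toward
      rw [hcol]
  · -- face turn
    obtain ⟨hdir, hsum, hoth⟩ := faceTurn_dirs hv (hf ▸ he)
    set I := tgtDir (hexp.cv (i - 1)) (hexp.cf i) with hI
    obtain ⟨J, hJI⟩ := exists_ne I
    have htgt : tgtDir (hexp.cv (i - 1)) (hexp.cf (i - 1)) = I := by rw [hf]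
    rw [htgt, hdir] at hz'
    have hc₁ : IsCorner (hexp.cv (i - 1)) (hexp.cf i) := hf ▸ hexp.isCorner (i := i - 1) (by omega)
    obtain ⟨hshape, h1, h2⟩ := fConn_shape hc₁ hJI hsum (hoth J hJI) (hf ▸ hz')
    refine ⟨I, J, hJI, htgt, hdir, hz', Or.inr ⟨hf, hv, hsum, hoth J hJI, hshape, fun h ↦ ?_, fun h ↦ ?_⟩⟩
    · rw [← hoth J hJI]; exact h1 h
    · rw [← hoth J hJI]; exact h2 h

/-- **The box of the `i`-th connector**: every point of `connPiece i` lies, in lattice units, in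
the box `NearEdge I a h` of the medial vertex at which the path turns, with `I` the source
direction of dart `i`, `a = cf i I` and `h = cv i J`. [folklore] -/
theorem IsMedialExploration.nearEdge_of_mem_connPiece {i : ℕ} (hi1 : 1 ≤ i) (hi : i < ((a :: l).zip l).length)
    (hδ : 0 < D.δ) {z : ℂ} (hz : z ∈ hexp.connPiece i) :
    ∃ I J : Fin 2, J ≠ I ∧ srcDir (hexp.cv i) (hexp.cf i) = I ∧
      NearEdge I (hexp.cf i I) (hexp.cv i J) (D.δ⁻¹ • z) := by
  obtain ⟨I, J, hJI, -, hsrc, -, hcase⟩ := hexp.connPiece_data hi1 hi hδ hz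
  refine ⟨I, J, hJI, hsrc, ?_⟩
  rcases hcase with ⟨-, -, -, -, hshape, -⟩ | ⟨-, -, -, -, hshape, h1, h2⟩
  · exact hshape.nearEdge
  · rcases hshape.nearEdge with ⟨hc, hN⟩ | ⟨hc, hN⟩
    · rw [h1 hc]; exact hN
    · rw [h2 hc]; exact hN

/-- **Distinct dart pieces are disjoint.** A common point lies in the open faces of both darts,
which therefore coincide; in each coordinate it is at offset in `[1/8, 3/8]` from the side
through the vertex, so the vertices coincide; no dart is used twice. [cite: Smirnov2001, §2] -/
theorem IsMedialExploration.disjoint_dartPiece (hδ : 0 < D.δ) {i j : ℕ} (hi : i < ((a :: l).zip l).length)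
    (hj : j < ((a :: l).zip l).length) (hij : i ≠ j) : Disjoint (hexp.dartPiece i) (hexp.dartPiece j) := by
  rw [Set.disjoint_left]
  intro z hzi hzj
  rw [hexp.dartPiece_eq, Set.mem_smul_set_iff_inv_smul_mem₀ hδ.ne'] at hzi hzj
  have hci := hexp.isCorner hi
  have hcj := hexp.isCorner hj
  have hff : hexp.cf i = hexp.cf j :=
    eq_of_mem_openSq_of_mem_openSq (dartSeg_subset_openSq hci hzi) (dartSeg_subset_openSq hcj hzj)
  have hvv : hexp.cv i = hexp.cv j := by
    funext k
    have h1 := dartSeg_coord hzi k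
    have h2 := dartSeg_coord hzj k
    rw [← hff] at h2
    rcases hci k with h | h <;> rcases hcj k with h' | h' <;> rw [← hff] at h'
    · rw [h, h']
    · obtain ⟨-, a2⟩ := h1.1 h; obtain ⟨b1, -⟩ := h2.2 h'; linarith
    · obtain ⟨a1, -⟩ := h1.2 h; obtain ⟨-, b2⟩ := h2.1 h'; linarith
    · rw [h, h']
  exact hij (hexp.corner_injective hi hj hvv hff)

/-- **A dart piece meets a connector only at its own ends**: if `dartPiece i` meets
`connPiece j` then `j = i` (at `pS i`) or `j = i + 1` (at `pT i`). The common point lies in the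
box of the turned-at edge, hence is a shifted side point of dart `i` lying at a corner of the
box, hence an endpoint of the connector; shifted side points determine the dart. [cite: Smirnov2001, §2] -/
theorem IsMedialExploration.eq_or_eq_of_dartPiece_inter_connPiece (hδ : 0 < D.δ) {i j : ℕ}
    (hi : i < ((a :: l).zip l).length) (hj1 : 1 ≤ j) (hj : j < ((a :: l).zip l).length)
    (h : (hexp.dartPiece i ∩ hexp.connPiece j).Nonempty) : j = i ∨ j = i + 1 := by
  obtain ⟨z, hzi, hzj⟩ := h
  rw [hexp.dartPiece_eq, Set.mem_smul_set_iff_inv_smul_mem₀ hδ.ne'] at hzi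
  have hci := hexp.isCorner hi
  obtain ⟨I, J, hJI, htgt, hsrc, hseg, hcase⟩ := hexp.connPiece_data hj1 hj hδ hzj
  set w := D.δ⁻¹ • z with hw
  -- `w` is the shifted side point of dart `i` in direction `I`, at a corner of the box
  have hN : NearEdge I (hexp.cf j I) (hexp.cv j J) w := by
    rcases hcase with ⟨-, -, -, -, hshape, -⟩ | ⟨-, -, -, -, hshape, h1, h2⟩
    · exact hshape.nearEdge
    · rcases hshape.nearEdge with ⟨hc, hN⟩ | ⟨hc, hN⟩
      · rw [h1 hc]; exact hN
      · rw [h2 hc]; exact hN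
  obtain ⟨hwpt, hwJ⟩ := eq_dartPt_of_mem_dartSeg_of_nearEdge hci hzi hN
  -- `w` is an endpoint of the connector
  have hend : w = dartPt (hexp.cv (j - 1)) (hexp.cf (j - 1)) I ∨ w = dartPt (hexp.cv j) (hexp.cf j) I := by
    rcases hcase with ⟨hv, hf, hcol, hside, hshape, hcoordI⟩ | ⟨hf, hv, hsum, hoth, hshape, h1, h2⟩
    · -- vertex connector: the coordinate `J` runs from `h - 1/8` to `h + 1/8`
      have hPQ : coordVec (dartPt (hexp.cv (j - 1)) (hexp.cf (j - 1)) I) J ≠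
          coordVec (dartPt (hexp.cv j) (hexp.cf j) I) J := by
        rw [coordVec_dartPt_of_ne _ _ hJI, coordVec_dartPt_of_ne _ _ hJI, hv]
        unfold inward
        rcases hside with ⟨h1, h2⟩ | ⟨h1, h2⟩
        · rw [if_neg (show ¬ hexp.cv j J = hexp.cf (j - 1) J by omega), if_pos h2.symm]
          have : (hexp.cf (j - 1) J : ℝ) = hexp.cf j J - 1 := by
            have : hexp.cf (j - 1) J = hexp.cf j J - 1 := by omega
            rw [this]; push_cast; ring
          rw [this]; intro h; linarith
        · rw [if_pos h1.symm, if_neg (show ¬ hexp.cv j J = hexp.cf j J by omega)]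
          have : (hexp.cf j J : ℝ) = hexp.cf (j - 1) J - 1 := by
            have : hexp.cf j J = hexp.cf (j - 1) J - 1 := by omega
            rw [this]; push_cast; ring
          rw [this]; intro h; linarith
      -- the two endpoint values of coordinate `J` are `h ∓ 1/8`; `w` has one of them
      have hvals : ∀ t : ℝ, t = hexp.cv j J - 1 / 8 ∨ t = hexp.cv j J + 1 / 8 →
          t = coordVec (dartPt (hexp.cv (j - 1)) (hexp.cf (j - 1)) I) J ∨
            t = coordVec (dartPt (hexp.cv j) (hexp.cf j) I) J := by
        intro t ht
        rw [coordVec_dartPt_of_ne _ _ hJI, coordVec_dartPt_of_ne _ _ hJI, hv]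
        unfold inward
        rcases hside with ⟨h1, h2⟩ | ⟨h1, h2⟩
        · rw [if_neg (show ¬ hexp.cv j J = hexp.cf (j - 1) J by omega), if_pos h2.symm]
          have e1 : (hexp.cf (j - 1) J : ℝ) = hexp.cv j J - 1 := by
            have : hexp.cf (j - 1) J = hexp.cv j J - 1 := by omega
            rw [this]; push_cast; ring
          have e2 : (hexp.cf j J : ℝ) = hexp.cv j J := by exact_mod_cast h2
          rw [e1, e2]
          rcases ht with rfl | rfl
          · left; ring
          · right; ring
        · rw [if_pos h1.symm, if_neg (show ¬ hexp.cv j J = hexp.cf j J by omega)]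
          have e1 : (hexp.cf (j - 1) J : ℝ) = hexp.cv j J := by exact_mod_cast h1
          have e2 : (hexp.cf j J : ℝ) = hexp.cv j J - 1 := by
            have : hexp.cf j J = hexp.cv j J - 1 := by omega
            rw [this]; push_cast; ring
          rw [e1, e2]
          rcases ht with rfl | rfl
          · right; ring
          · left; ring
      rcases hvals _ (hwJ J hJI) with h' | h'
      · exact Or.inl (eq_left_of_mem_segment_of_coordVec_eq hPQ hseg h')
      · exact Or.inr (eq_right_of_mem_segment_of_coordVec_eq hPQ hseg h')
    · -- face connector: the coordinate `I` runs between `a + 3/8` and `a + 5/8`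
      have hci' : IsCorner (hexp.cv (j - 1)) (hexp.cf j) := hf ▸ hexp.isCorner (i := j - 1) (by omega)
      have hcj := hexp.isCorner hj
      have hPQ : coordVec (dartPt (hexp.cv (j - 1)) (hexp.cf (j - 1)) I) I ≠
          coordVec (dartPt (hexp.cv j) (hexp.cf j) I) I := by
        rw [coordVec_dartPt_self, coordVec_dartPt_self, hf]
        unfold toward
        rcases hci' I with h1 | h1
        · rw [if_pos h1, if_neg (show ¬ hexp.cv j I = hexp.cf j I by omega)]; norm_num
        · rw [if_neg (show ¬ hexp.cv (j - 1) I = hexp.cf j I by omega), if_pos (show hexp.cv j I = hexp.cf j I by omega)]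
          norm_num
      -- `w = dartPt (cv i) (cf i) I` has coordinate `I` in `{cf i I + 3/8, cf i I + 5/8}` and in the window
      have hwI : coordVec w I = coordVec (dartPt (hexp.cv (j - 1)) (hexp.cf (j - 1)) I) I ∨
          coordVec w I = coordVec (dartPt (hexp.cv j) (hexp.cf j) I) I := by
        obtain ⟨-, ⟨hlo, hhi⟩, -⟩ := hshape
        have hwI' : coordVec w I = hexp.cf i I + toward (hexp.cv i) (hexp.cf i) I := by
          rw [hwpt, coordVec_dartPt_self]
        -- the integer parts agree
        have ha : hexp.cf i I = hexp.cf j I := by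
          rw [hwI'] at hlo hhi
          rcases toward_eq (hexp.cv i) (hexp.cf i) I with ⟨-, ht⟩ | ⟨-, ht⟩ <;> rw [ht] at hlo hhi <;>
            exact int_eq_of_abs_sub_lt_one (by linarith) (by linarith)
        rw [coordVec_dartPt_self, coordVec_dartPt_self, hf, hwI', ha]
        unfold toward
        rcases hci' I with h1 | h1
        · rw [if_pos h1, if_neg (show ¬ hexp.cv j I = hexp.cf j I by omega)]
          split_ifs
          · exact Or.inl rfl
          · exact Or.inr rfl
        · rw [if_neg (show ¬ hexp.cv (j - 1) I = hexp.cf j I by omega), if_pos (show hexp.cv j I = hexp.cf j I by omega)]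
          split_ifs
          · exact Or.inr rfl
          · exact Or.inl rfl
      rcases hwI with h' | h'
      · exact Or.inl (eq_left_of_mem_segment_of_coordVec_eq hPQ hseg h')
      · exact Or.inr (eq_right_of_mem_segment_of_coordVec_eq hPQ hseg h')
  -- compare the shifted side points
  rcases hend with hend | hend
  · rw [hwpt] at hend
    obtain ⟨hv, hf, hd⟩ := eq_of_dartPt_eq hci (hexp.isCorner (i := j - 1) (by omega)) hend
    have := hexp.corner_injective hi (j := j - 1) (by omega) hv hf
    right; omega
  · rw [hwpt] at hend
    obtain ⟨hv, hf, hd⟩ := eq_of_dartPt_eq hci (hexp.isCorner hj) hend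
    exact Or.inl (hexp.corner_injective hi hj hv hf).symm

/-- **Distinct connectors are disjoint.** A common point lies in the boxes of both turned-at
edges, which therefore coincide (same direction, column and level); two vertex turns at that
edge turn around the same vertex (the constant coordinate) and start the same dart; two face
turns follow the same side inside the same face (the level of the connector) with the same or
swapped corners; a vertex turn crosses a closed edge while a face turn follows an open one.
[cite: Smirnov2001, §2] -/
theorem IsMedialExploration.eq_of_connPiece_inter_connPiece (hδ : 0 < D.δ) {i j : ℕ} (hi1 : 1 ≤ i)
    (hi : i < ((a :: l).zip l).length) (hj1 : 1 ≤ j) (hj : j < ((a :: l).zip l).length)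
    (h : (hexp.connPiece i ∩ hexp.connPiece j).Nonempty) : i = j := by
  obtain ⟨z, hzi, hzj⟩ := h
  set w := D.δ⁻¹ • z with hw
  obtain ⟨I, J, hJI, htgt, hsrc, hseg, hcase⟩ := hexp.connPiece_data hi1 hi hδ hzi
  obtain ⟨I', J', hJI', htgt', hsrc', hseg', hcase'⟩ := hexp.connPiece_data hj1 hj hδ hzj
  -- the boxes
  have hN : ∃ hh : ℤ, NearEdge I (hexp.cf i I) hh w ∧ hh = hexp.cv i J := by
    rcases hcase with ⟨-, -, -, -, hshape, -⟩ | ⟨-, -, -, -, hshape, h1, h2⟩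
    · exact ⟨_, hshape.nearEdge, rfl⟩
    · rcases hshape.nearEdge with ⟨hc, hN⟩ | ⟨hc, hN⟩
      · exact ⟨_, hN, (h1 hc).symm⟩
      · exact ⟨_, hN, (h2 hc).symm⟩
  have hN' : ∃ hh : ℤ, NearEdge I' (hexp.cf j I') hh w ∧ hh = hexp.cv j J' := by
    rcases hcase' with ⟨-, -, -, -, hshape, -⟩ | ⟨-, -, -, -, hshape, h1, h2⟩
    · exact ⟨_, hshape.nearEdge, rfl⟩
    · rcases hshape.nearEdge with ⟨hc, hN⟩ | ⟨hc, hN⟩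
      · exact ⟨_, hN, (h1 hc).symm⟩
      · exact ⟨_, hN, (h2 hc).symm⟩
  obtain ⟨hh, hNw, rfl⟩ := hN
  obtain ⟨hh', hNw', rfl⟩ := hN'
  obtain ⟨hII, hcol, hlev⟩ := eq_of_nearEdge_of_nearEdge hNw hNw'
  subst hII
  have hJJ : J = J' := by
    rcases fin_two_cases_of_ne hJI J' with h' | h'
    · exact absurd h' hJI'
    · exact h'.symm
  subst hJJ
  have hci := hexp.isCorner hi
  have hcj := hexp.isCorner hj
  have hci1 := hexp.isCorner (i := i - 1) (by omega)
  have hcj1 := hexp.isCorner (i := j - 1) (by omega)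
  -- sites from their two coordinates
  have site_ext : ∀ {x y : Site 2}, x I = y I → x J = y J → x = y := by
    intro x y h1 h2
    funext k
    rcases fin_two_cases_of_ne hJI k with rfl | rfl
    · exact h1
    · exact h2
  rcases hcase with ⟨hv, hf, hcolI, hside, hshape, hcoordI⟩ | ⟨hf, hv, hsum, hoth, hshape, h1, h2⟩ <;>
    rcases hcase' with ⟨hv', hf', hcolI', hside', hshape', hcoordI'⟩ | ⟨hf', hv', hsum', hoth', hshape', h1', h2'⟩
  · -- vertex / vertex: same vertex, same source edge, same dart
    have hvI : hexp.cv i I = hexp.cv j I := by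
      rw [hcoordI] at hcoordI'
      rw [hcol] at hcoordI'
      have ht : toward (hexp.cv i) (hexp.cf i) I = toward (hexp.cv j) (hexp.cf j) I := by linarith
      rcases toward_eq (hexp.cv i) (hexp.cf i) I with ⟨h1, e1⟩ | ⟨h1, e1⟩ <;>
        rcases toward_eq (hexp.cv j) (hexp.cf j) I with ⟨h2, e2⟩ | ⟨h2, e2⟩ <;> rw [e1, e2] at ht <;> norm_num at ht
      · rw [h1, h2, hcol]
      · rcases hci I with h' | h' <;> rcases hcj I with h'' | h'' <;> omega
    have hvv : hexp.cv i = hexp.cv j := site_ext hvI hlev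
    have hsrc'' : srcDir (hexp.cv i) (hexp.cf j) = I := by rw [hvv]; exact hsrc'
    have hsrcEq : cornerSource (hexp.cv i) (hexp.cf i) = cornerSource (hexp.cv i) (hexp.cf j) := by
      rw [cornerSource_eq_cornerEdge, cornerSource_eq_cornerEdge, hsrc, hsrc'', cornerEdge, cornerEdge]
      congr 1
      refine site_ext ?_ ?_
      · simp only [cornerNeighbor, Function.update_self, hcol, hvI]
      · rw [cornerNeighbor_apply_of_ne hJI, cornerNeighbor_apply_of_ne hJI]
    have hff : hexp.cf i = hexp.cf j := eq_of_cornerSource_eq hci (hvv ▸ hcj) hsrcEq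
    exact hexp.corner_injective hi hj hvv hff
  · -- vertex at `i` / face at `j`: the edge would be both closed and open
    exfalso
    rcases hexp.turn_cases hi1 hi with ⟨-, -, hdual, hclosed⟩ | ⟨hf₀, -, -, -⟩
    swap; · exact hf hf₀
    rcases hexp.turn_cases hj1 hj with ⟨-, hf₀, -, -⟩ | ⟨-, -, hedge, hopen⟩
    · exact hf₀ hf'
    -- the two medial vertices are the same lattice edge
    have hei : (((a :: l).zip l)[i]).1 = cornerEdge (hexp.cv i) (hexp.cf i) I := by
      rw [← (hexp.corner_spec hi).2.2.1, cornerSource_eq_cornerEdge, hsrc]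
    have heij : (((a :: l).zip l)[i]).1 = (((a :: l).zip l)[j]).1 := by
      rw [hei, hedge, cornerEdge]
      -- both edges join the two sites of level `cv i J` in columns `cf i I`, `cf i I + 1`
      have hnbI : cornerNeighbor (hexp.cv i) (hexp.cf i) I I = 2 * hexp.cf i I + 1 - hexp.cv i I := by
        simp [cornerNeighbor]
      have hnbJ : cornerNeighbor (hexp.cv i) (hexp.cf i) I J = hexp.cv i J := cornerNeighbor_apply_of_ne hJI
      have hfI' : hexp.cf (j - 1) I = hexp.cf j I := congrFun hf' I
      rw [Sym2.eq_iff]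
      by_cases hc : hexp.cv i I = hexp.cv (j - 1) I
      · left
        refine ⟨site_ext hc (by rw [hlev, hoth']), site_ext ?_ (by rw [hnbJ, hlev])⟩
        rw [hnbI]
        rcases hci I with h1 | h1 <;> rcases hcj1 I with h2 | h2 <;> rcases hcj I with h3 | h3 <;> omega
      · right
        refine ⟨site_ext ?_ (by rw [hlev]), site_ext ?_ (by rw [hnbJ, hlev, hoth'])⟩
        · rcases hci I with h1 | h1 <;> rcases hcj1 I with h2 | h2 <;> rcases hcj I with h3 | h3 <;> omega
        · rw [hnbI]
          rcases hci I with h1 | h1 <;> rcases hcj1 I with h2 | h2 <;> rcases hcj I with h3 | h3 <;> omega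
    rw [heij] at hclosed
    rw [mem_dualConfig_iff] at hclosed
    exact hclosed.2 _ hopen rfl
  · -- face at `i` / vertex at `j`: symmetric
    exfalso
    rcases hexp.turn_cases hj1 hj with ⟨-, -, hdual, hclosed⟩ | ⟨hf₀, -, -, -⟩
    swap; · exact hf' hf₀
    rcases hexp.turn_cases hi1 hi with ⟨-, hf₀, -, -⟩ | ⟨-, -, hedge, hopen⟩
    · exact hf₀ hf
    have hej : (((a :: l).zip l)[j]).1 = cornerEdge (hexp.cv j) (hexp.cf j) I := by
      rw [← (hexp.corner_spec hj).2.2.1, cornerSource_eq_cornerEdge, hsrc']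
    have heij : (((a :: l).zip l)[j]).1 = (((a :: l).zip l)[i]).1 := by
      rw [hej, hedge, cornerEdge]
      have hnbI : cornerNeighbor (hexp.cv j) (hexp.cf j) I I = 2 * hexp.cf j I + 1 - hexp.cv j I := by
        simp [cornerNeighbor]
      have hnbJ : cornerNeighbor (hexp.cv j) (hexp.cf j) I J = hexp.cv j J := cornerNeighbor_apply_of_ne hJI
      have hfI : hexp.cf (i - 1) I = hexp.cf i I := congrFun hf I
      rw [Sym2.eq_iff]
      by_cases hc : hexp.cv j I = hexp.cv (i - 1) I
      · left
        refine ⟨site_ext hc (by rw [hoth, hlev]), site_ext ?_ (by rw [hnbJ, hlev])⟩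
        rw [hnbI]
        rcases hcj I with h1 | h1 <;> rcases hci1 I with h2 | h2 <;> rcases hci I with h3 | h3 <;> omega
      · right
        refine ⟨site_ext ?_ (by rw [hlev]), site_ext ?_ (by rw [hnbJ, hoth, hlev])⟩
        · rcases hcj I with h1 | h1 <;> rcases hci1 I with h2 | h2 <;> rcases hci I with h3 | h3 <;> omega
        · rw [hnbI]
          rcases hcj I with h1 | h1 <;> rcases hci1 I with h2 | h2 <;> rcases hci I with h3 | h3 <;> omega
    rw [heij] at hclosed
    rw [mem_dualConfig_iff] at hclosed
    exact hclosed.2 _ hopen rfl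
  · -- face / face: same face and same side; the corners are equal or swapped
    have hfJ : hexp.cf i J = hexp.cf j J := by
      obtain ⟨-, -, hJv⟩ := hshape
      obtain ⟨-, -, hJv'⟩ := hshape'
      rcases hJv with e | e <;> rcases hJv' with e' | e' <;> rw [e] at e' <;>
        exact int_eq_of_abs_sub_lt_one (by linarith) (by linarith)
    have hff : hexp.cf i = hexp.cf j := site_ext hcol hfJ
    -- corners: `{cv (i-1), cv i}` and `{cv (j-1), cv j}` both span the side at level `cv i J`
    by_cases hvI : hexp.cv i I = hexp.cv j I
    · have hvv : hexp.cv i = hexp.cv j := site_ext hvI hlev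
      exact hexp.corner_injective hi hj hvv hff
    · -- swapped corners: `cv i = cv (j-1)` and `cv (i-1) = cv j`, absurd
      exfalso
      have hfI' : hexp.cf (j - 1) I = hexp.cf j I := congrFun hf' I
      have hfim : hexp.cf (i - 1) I = hexp.cf i I := congrFun hf I
      have e1 : hexp.cv i I = hexp.cv (j - 1) I := by
        rcases hci I with h1 | h1 <;> rcases hcj I with h2 | h2 <;> rcases hcj1 I with h3 | h3 <;> omega
      have e2 : hexp.cv (i - 1) I = hexp.cv j I := by
        rcases hci1 I with h1 | h1 <;> rcases hcj I with h2 | h2 <;> rcases hci I with h3 | h3 <;> omega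
      have hv1 : hexp.cv i = hexp.cv (j - 1) := site_ext e1 (by rw [hlev, hoth'])
      have hv2 : hexp.cv (i - 1) = hexp.cv j := site_ext e2 (by rw [hoth, hlev])
      have k1 := hexp.corner_injective hi (j := j - 1) (by omega) hv1 (by rw [hff, hf'])
      have k2 := hexp.corner_injective (i := i - 1) (by omega) hj hv2 (by rw [hf, hff])
      omega

/-- **Stretches of the perturbed polygon over separated dart ranges are disjoint**: if
`i₀ + k < j₀` then the stretch over the darts `i₀, …, i₀ + k` and the stretch over
`j₀, …, j₀ + k'` have disjoint ranges (their pieces have indices differing by at least one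
dart, so no dart/dart, dart/connector or connector/connector pair can meet). This is the
simplicity of the perturbed exploration polygon in the form used by the three-arcs lemma.
[cite: AizenmanBurchardDuke1999, Appendix A] -/
theorem IsMedialExploration.disjoint_range_subPath (hδ : 0 < D.δ) {i₀ k j₀ k' : ℕ} (hsep : i₀ + k < j₀)
    (hj : j₀ + k' < ((a :: l).zip l).length) :
    Disjoint (range (hexp.subPath i₀ k)) (range (hexp.subPath j₀ k')) := by
  rw [Set.disjoint_left]
  intro z hz₁ hz₂
  rcases hexp.range_subPath_subset i₀ k hz₁ with h₁ | h₁ <;>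
    rcases hexp.range_subPath_subset j₀ k' hz₂ with h₂ | h₂ <;>
    obtain ⟨p, hp, hzp⟩ := mem_iUnion₂.1 h₁ <;> obtain ⟨p', hp', hzp'⟩ := mem_iUnion₂.1 h₂
  · -- dart / dart
    exact Set.disjoint_left.1 (hexp.disjoint_dartPiece hδ (i := i₀ + p) (j := j₀ + p') (by omega) (by omega)
      (by omega)) hzp hzp'
  · -- dart / connector
    rcases hexp.eq_or_eq_of_dartPiece_inter_connPiece hδ (i := i₀ + p) (j := j₀ + p') (by omega) (by omega)
      (by omega) ⟨z, hzp, hzp'⟩ with h | h <;> omega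
  · -- connector / dart
    rcases hexp.eq_or_eq_of_dartPiece_inter_connPiece hδ (i := j₀ + p') (j := i₀ + p) (by omega) (by omega)
      (by omega) ⟨z, hzp', hzp⟩ with h | h <;> omega
  · -- connector / connector
    have := hexp.eq_of_connPiece_inter_connPiece hδ (i := i₀ + p) (j := j₀ + p') (by omega) (by omega)
      (by omega) (by omega) ⟨z, hzp, hzp'⟩
    omega

end IsMedialExploration

end Literature.Probability.LatticeModels

end
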